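import Summits.QuantumFields.YangMills.Theorems.BalabanUVNodesN15KingModelBoxBulkLimit
import Summits.QuantumFields.YangMills.Theorems.BalabanUVNodesN15KingModelFreeKernelHarnack
import Summits.QuantumFields.YangMills.Theorems.BalabanUVNodesN15KingModelFreeKernelUniqueness
import Summits.QuantumFields.YangMills.Theorems.BalabanUVNodesN15KingModelFreeKernelMoments
import Summits.QuantumFields.YangMills.Theorems.BalabanUVNodesN15KingModelTorusFreeDeterminant
import HarnessLib

/-!
# BalabanUVNodes ∕ N15 — THE KING-MODEL RUNG (PART Ε by name): THE BRIDGE TO THE PRINTED FORM, PACKAGED —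
# the free kernel `K_∞`, King's torus covariance as its periodisation and in King's plane waves, [Ba 4] (2.42)'s image series for the free-boundary box, uniform decay,
# the torus ∕ box ∕ infinite-lattice twins and thermodynamic limits, positivity, uniqueness, `ℓ¹`-norm, and the free determinant — twelve headlines in one conjunction
# (Track A, DAG node N15 = NE2; FAN-OUT v1.1 §N15 s3 «KING-MODEL RUNG»; count-neutral)

HONEST FRAMING.  Count-neutral (cell `pub-ymgap`, seat `pub-ymgap-dag-n15-e` g40; `--supports stmt-QuantumFields-27366 --as helper` = K3⁸).
TEMPLATE LITERATURE: C. King, Commun. Math. Phys. **102** (1986) 649–677 [King1986], §4 p.670 l.8–13 («By using multiple reflection representations, the propagators G^η_k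
and G^η_k(Ω) can be written in terms of the operator defined by (2.13) with free boundary conditions (and A = 0, of course) … Such representations are given explicitly in
[Ba 4]»), (4.4) p.670, (4.35) p.674, (3.89) p.668; [Balaban1983RegularityDecay] (2.42)–(2.44) p.584; [Balaban1984PropagatorsI] (1.29) p.23, p.36 l.20–23, p.38 (1.126).
THIS FILE proves nothing new: ★★★ **`king_freeKernel_package`** is the conjunction, BY NAME, of the headline theorems of parts Ε-a … Ε-k (files
`…FreeLatticeKernel`, `…TorusPeriodisation`, `…BoxImagesPrinted`, `…FreeCovarianceDecay`, `…TorusPlaneWaves`, `…FreeKernelThermodynamicLimit`, `…BoxBulkLimit`,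
`…FreeKernelHarnack`, `…FreeKernelUniqueness`, `…FreeKernelMoments`, `…TorusFreeDeterminant`), for a referee who wants one `#print axioms`.  For every `d`, every period vector
`K` (all `K_μ ≥ 1`), every box `Π_μ{0,…,n_μ−1}`, every `c ≥ 0`, `m² > 0`:
(1) the Green equation of `K_∞` on ℤ^{d+1}; (2) King's torus covariance is the periodisation of `K_∞`; (3) it is King's plane-wave sum `|Ω|⁻¹Σ_q e^{iq·(x−y)}∕lapSym(q)`;
(4) the free-boundary box covariance is [Ba 4]'s image series `imK` of `K_∞` (pv17); (5) the volume-uniform torus decay `(2∕m²)periodConst·e^{−(κ_F∕(d+1))d_T}`; (6) the box decay;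
(7) the thermodynamic limit along cubes (periodic b.c.) is `K_∞`; (8) the free-b.c. bulk limit is the SAME `K_∞`; (9) `K_∞ > 0` for `c > 0`; (10) a bounded left inverse kernel
of `c(−Δ)+m²` on ℤ^{d+1} IS `K_∞(x−x′)`; (11) `Σ_z|K_∞(z)| = 1∕m²`; (12) `det(lapF K c m²) = Π_q lapSym(q)`.

NOT Bałaban's covariant objects; NOT a node discharge (N15 is booked through n15-a's knit, untouched); nothing continuum-YM ∕ `ℝ⁴` ∕ OS ∕ Clay.  0 `sorry`, 0 `def`.
Locators: [King1986] §4 p.670 l.8–13, (2.13) p.653, (4.4) p.670, (4.35) p.674, (3.89) p.668; [Balaban1983RegularityDecay] (2.42)–(2.44) p.584, p.586 l.9–15;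
[Balaban1984PropagatorsI] (1.29) p.23, p.36 l.20–23, p.38 (1.126).
-/

noncomputable section

open scoped BigOperators Topology
open Finset Filter

namespace Summit.QuantumFields.YangMills.BalabanUVNodes.N15KingModelRung.TorusSpectral

open Literature.MathematicalPhysics.QuantumFieldTheory.Balaban1983to89.B5Prop11Plancherel (Tor chi)
open Literature.MathematicalPhysics.QuantumFieldTheory.Balaban1983to89.B4Green244 (e)
open Literature.MathematicalPhysics.QuantumFieldTheory.Balaban1983to89.B4TorusKernel (periodConst)
open Literature.MathematicalPhysics.QuantumFieldTheory.Balaban1983to89.B4TorusKernel.MultiPeriod (translate)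
open Literature.MathematicalPhysics.QuantumFieldTheory.Balaban1983to89.B4Reflection242 (box opK opSupp)
open Literature.MathematicalPhysics.QuantumFieldTheory.Balaban1983to89.B4Reflection242.ImageSystem (imK)
open Literature.MathematicalPhysics.QuantumFieldTheory.King1986.Torus

variable {d : ℕ}

/-- ★★★ **PART Ε BY NAME — THE BRIDGE TO THE PRINTED FORM.**  For every period vector `K`, box sides `n`, `c ≥ 0`, `m² > 0`: (1) `freeKer_green`; (2) `lapF_inv_eq_tsum_freeKer`;
(3) `lapF_inv_apply_eq_fourier`; (4) `boxOp_inv_eq_imK`; (5) `abs_lapF_inv_le_exp_tdistT`; (6) `boxOp_inv_le_exp`; (7) `tendsto_lapF_inv_cube`; (8) `tendsto_boxOp_inv_bulk`;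
(9) `freeKer_pos` (for `c > 0`); (10) `freeKer_unique_of_leftInverse_real`; (11) `tsum_abs_freeKer`; (12) `det_lapF_eq_prod_lapSym`.
[cite: King1986, §4 p.670 l.8–13, (4.4) p.670, (4.35) p.674, (3.89) p.668; Balaban1983RegularityDecay, (2.42)–(2.44) p.584; Balaban1984PropagatorsI, (1.29) p.23, p.36 l.20–23, p.38 (1.126)] -/
theorem king_freeKernel_package (K : Fin (d + 1) → ℕ) [∀ μ, NeZero (K μ)] (n : Fin (d + 1) → ℕ) [∀ μ, NeZero (n μ)] {c m2 : ℝ} (hc : 0 ≤ c) (hm : 0 < m2) :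
    -- (1) the Green equation of the free kernel on ℤ^{d+1}
    (∀ z : Fin (d + 1) → ℤ, m2 * freeKer c m2 z + c * ∑ μ, (2 * freeKer c m2 z - freeKer c m2 (z + e μ) - freeKer c m2 (z - e μ)) = if z = 0 then 1 else 0) ∧
    -- (2) King's torus covariance is the periodisation of `K_∞`
    (∀ x y : Tor K, (lapF K c m2)⁻¹ x y = ∑' m : Fin (d + 1) → ℤ, freeKer c m2 (translate K (torRepZ K x - torRepZ K y) m)) ∧
    -- (3) … and King's plane-wave sum
    (∀ x y : Tor K, (lapF K c m2)⁻¹ x y = (Fintype.card (Tor K) : ℝ)⁻¹ * ∑ q : Tor K, (lapSym K c m2 q)⁻¹ * (chi K q (x - y)).re) ∧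
    -- (4) the free-boundary box covariance is [Ba 4]'s image series (pv17 `imK`)
    (∀ s t : KingBox n, (boxOp n c m2)⁻¹ s t = (box n (one_le_period n)).imK (fun u w => freeKer c m2 (u - w)) (kingBoxZ n s) (kingBoxZ n t)) ∧
    -- (5) volume-uniform decay on the torus
    (∀ x y : Tor K, |(lapF K c m2)⁻¹ x y| ≤ 2 / m2 * periodConst (kappaFree c m2 d) d * Real.exp (-(kappaFree c m2 d / (d + 1) * tdistT K x y))) ∧
    -- (6) … and on the box
    (∀ s t : KingBox n, 0 ≤ (boxOp n c m2)⁻¹ s t ∧ (boxOp n c m2)⁻¹ s t ≤ 2 ^ (d + 1) * (2 / m2 * periodConst (kappaFree c m2 d) d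
        * Real.exp (-(kappaFree c m2 d / (d + 1) * tdistT (dblPer n) (dblBox n s) (dblBox n t))))) ∧
    -- (7) the thermodynamic limit with periodic boundary conditions
    (∀ z : Fin (d + 1) → ℤ, Tendsto (fun N : ℕ => (lapF (fun _ : Fin (d + 1) => N + 1) c m2)⁻¹ (cubePt N z) 0) atTop (𝓝 (freeKer c m2 z))) ∧
    -- (8) the thermodynamic limit with free boundary conditions (same limit)
    (∀ z : Fin (d + 1) → ℤ, Tendsto (fun N : ℕ => (boxOp (fun _ : Fin (d + 1) => 2 * N + 1) c m2)⁻¹ (bulkPt N z) (bulkPt N 0)) atTop (𝓝 (freeKer c m2 z))) ∧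
    -- (9) strict positivity (for `c > 0`)
    (0 < c → ∀ z : Fin (d + 1) → ℤ, 0 < freeKer c m2 z) ∧
    -- (10) uniqueness among bounded left inverse kernels (real stencil form)
    (∀ (G : (Fin (d + 1) → ℤ) → (Fin (d + 1) → ℤ) → ℝ) (B : ℝ), (∀ u w, |G u w| ≤ B) →
      (∀ x x', m2 * G x x' + c * ∑ μ, (2 * G x x' - G (x + e μ) x' - G (x - e μ) x') = if x = x' then 1 else 0) →
        ∀ x x', G x x' = freeKer c m2 (x - x')) ∧
    -- (11) the ℓ¹ norm
    (∑' z : Fin (d + 1) → ℤ, |freeKer c m2 z| = m2⁻¹) ∧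
    -- (12) the free determinant on the torus
    ((lapF K c m2).det = ∏ q : Tor K, lapSym K c m2 q) :=
  ⟨freeKer_green hc hm,
    lapF_inv_eq_tsum_freeKer K hc hm,
    lapF_inv_apply_eq_fourier K hc hm,
    boxOp_inv_eq_imK n hc hm,
    abs_lapF_inv_le_exp_tdistT K hc hm,
    boxOp_inv_le_exp n hc hm,
    tendsto_lapF_inv_cube hc hm,
    tendsto_boxOp_inv_bulk hc hm,
    fun hc' => freeKer_pos hc' hm,
    fun _ _ hGB hL => freeKer_unique_of_leftInverse_real hc hm hGB hL,
    tsum_abs_freeKer hc hm,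
    det_lapF_eq_prod_lapSym K c m2⟩

end Summit.QuantumFields.YangMills.BalabanUVNodes.N15KingModelRung.TorusSpectral

end
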